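import Summits.QuantumFields.YangMills.Theorems.ContractibleFibreFibreToTorusTubeInvariance

/-!
# `tubeLimit_strong`: the free-tube limit state — DLR, long-direction invariant, clustering on all cylinders

Strengthened, REUSABLE form of stub (T) `stub_tubeLimitState` of crux `FibreToTorus`
(stmt-QuantumFields-16244), line `uniqueness`, route `ContractibleFibre` (same hypothesis verbatim): the
`M`-uniform free-tube family at `(β, m)` yields a probability measure `μ` on `LGConfig 4 G` which
(i) is a DLR state of the Wilson specification, (ii) is invariant under the two LONG lattice translations
`e₀, e₁` (the tubes are periodic in both; `LongDirectionInvariance` of the re-cut `ergodic-selection`), and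
(iii) clusters in Euclidean time at the tube rate `m` on ALL pairs of bounded measurable cylinder observables
(not only gauge-invariant ones), with a constant depending on the observables only.  The construction is that of
`stub_tubeLimitState` (diagonal tube sequence, centred chart, local DLR identities, Prokhorov, DLR-averaging for
measurable cylinders); (ii) is `map_configShift_chartState_eq` + `map_eq_of_tendsto_of_map_eq`.
-/

noncomputable section

open scoped BigOperators Topology
open Filter Function MeasureTheory Finset
open Literature.MathematicalPhysics.QuantumFieldTheory (haarProbability LatticeRep IsCompactSimpleLieGroup
  YMSpecies)
open Literature.Probability.LatticeModels (Site glueWith)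
open Literature.MathematicalPhysics.QuantumLattice (LGConfig ZdEdge configShift configShift_apply
  IsCylinder LocalGaugeObservable ymGibbsMeasures ymSpecification plaquettesTouching plaquetteEdges
  wilsonBoundaryAction exists_bound_of_continuous integrable_of_bound measurable_glueWith_prod
  continuous_wilsonBoundaryAction integral_ymSpecification infiniteVolumeLimitPoints)

namespace Summit.QuantumFields.YangMills.Theorems.FibreToTorus

/-- The product of a bounded measurable cylinder observable with a translate of another is a measurable cylinder
observable (raw-function form of `prodShift_cylinder`). [folklore] -/
theorem prodShift_cylinder' {G : Type} [MeasurableSpace G] {F₁ F₂ : LGConfig 4 G → ℝ}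
    {S₁ S₂ : Finset (ZdEdge 4)} (h₁m : Measurable F₁) (h₂m : Measurable F₂) (h₁S : IsCylinder F₁ S₁)
    (h₂S : IsCylinder F₂ S₂) (v : Site 4) :
    Measurable (fun U : LGConfig 4 G => F₁ U * F₂ (configShift v U)) ∧
      IsCylinder (fun U : LGConfig 4 G => F₁ U * F₂ (configShift v U))
        (S₁ ∪ S₂.image fun e => (e.1 - v, e.2)) ∧
      Measurable (fun U : LGConfig 4 G => F₂ (configShift v U)) ∧
      IsCylinder (fun U : LGConfig 4 G => F₂ (configShift v U)) (S₂.image fun e => (e.1 - v, e.2)) := by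
  have hB : IsCylinder (fun U : LGConfig 4 G => F₂ (configShift v U)) (S₂.image fun e => (e.1 - v, e.2)) := by
    intro U V h
    refine h₂S fun e he => ?_
    simp only [configShift_apply]
    exact h _ (mem_coe.2 (mem_image_of_mem (fun e : ZdEdge 4 => (e.1 - v, e.2)) (mem_coe.1 he)))
  refine ⟨h₁m.mul (h₂m.comp (configShift v).measurable), ?_, h₂m.comp (configShift v).measurable, hB⟩
  intro U V h
  have e1 : F₁ U = F₁ V := h₁S fun e he => h e (mem_coe.2 (mem_union_left _ (mem_coe.1 he)))
  have e2 : F₂ (configShift v U) = F₂ (configShift v V) :=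
    hB fun e he => h e (mem_coe.2 (mem_union_right _ (mem_coe.1 he)))
  show F₁ U * F₂ (configShift v U) = F₁ V * F₂ (configShift v V)
  rw [e1, e2]

/-- Lattice translations of `ℤ⁴`-configurations are continuous (product topology). [folklore] -/
theorem continuous_configShift {G : Type} [MeasurableSpace G] [TopologicalSpace G] (v : Site 4) :
    Continuous fun U : LGConfig 4 G => configShift v U := by
  have h : (fun U : LGConfig 4 G => (configShift v U : LGConfig 4 G)) = fun U e => U (e.1 - v, e.2) := by
    funext U e; exact configShift_apply v U e
  rw [h]
  exact continuous_pi fun e => continuous_apply _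

/-- **`tubeLimit_strong`** (hypothesis verbatim that of `stub_tubeLimitState`): the `M`-uniform free-tube
family at `(β, m)` yields a probability DLR state on `ℤ⁴`, invariant under the long translations `e₀, e₁`,
clustering in time at rate `m` on all bounded measurable cylinder observables. -/
theorem tubeLimit_strong :
    ∀ (G : Type) [Group G] [TopologicalSpace G] [IsTopologicalGroup G] [CompactSpace G]
      [MeasurableSpace G] [BorelSpace G], IsCompactSimpleLieGroup G → ∀ r : LatticeRep G,
      let Tube := fun (M : ℕ) (β m C : ℝ) (w Lmin : ℕ) => ∀ (L : ℕ) [NeZero L], Lmin ≤ L →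
        let St := ZMod L × ZMod L × Fin (M + 1) × Fin (M + 1);
        let Cfg := St × Fin 4 → G;
        let ν : MeasureTheory.Measure Cfg := MeasureTheory.Measure.pi fun _ => haarProbability G;
        let sh : St → Fin 4 → St := fun x μ => ![(x.1 + 1, x.2.1, x.2.2.1, x.2.2.2), (x.1, x.2.1 + 1, x.2.2.1, x.2.2.2), (x.1, x.2.1, x.2.2.1 + 1, x.2.2.2), (x.1, x.2.1, x.2.2.1, x.2.2.2 + 1)] μ;
        let ins : St → Fin 4 → Fin 4 → ℝ := fun x μ κ => if ((μ = 2 ∨ κ = 2) → (x.2.2.1 : ℕ) < M) ∧ ((μ = 3 ∨ κ = 3) → (x.2.2.2 : ℕ) < M) then 1 else 0;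
        let pl : Cfg → St → Fin 4 → Fin 4 → G := fun U x μ κ => U (x, μ) * U (sh x μ, κ) * (U (sh x κ, μ))⁻¹ * (U (x, κ))⁻¹;
        let act : Cfg → ℝ := fun U => β * ∑ x : St, ∑ q : {q : Fin 4 × Fin 4 // q.1 < q.2}, ins x q.1.1 q.1.2 * (r.ρ (pl U x q.1.1 q.1.2)).trace.re;
        let wgt : Cfg → ℝ := fun U => Real.exp (act U);
        let Ex : (Cfg → ℝ) → ℝ := fun F => (∫ U, F U * wgt U ∂ν) / (∫ U, wgt U ∂ν);
        let σ : ℕ → Cfg → Cfg := fun n U p => U ((p.1.1 + n, p.1.2), p.2);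
        ∀ c : ZMod L,
        let Loc := fun F : Cfg → ℝ => Measurable F ∧ (∀ U, |F U| ≤ 1) ∧ ∀ U U', (∀ p : St × Fin 4, (p.1.1 - c).val ≤ w → U p = U' p) → F U = F U';
        ∀ F₁ F₂ : Cfg → ℝ, Loc F₁ → Loc F₂ → ∀ n : ℕ, 2 * n < L → |Ex (fun U => F₁ U * F₂ (σ n U)) - Ex F₁ * Ex (fun U => F₂ (σ n U))| ≤ C * Real.exp (-(m * n));
      ∀ (β m : ℝ), 0 < m → (∀ w : ℕ, ∃ C : ℝ, ∀ M : ℕ, ∃ Lmin : ℕ, Tube M β m C w Lmin) →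
        ∃ μ : MeasureTheory.Measure (LGConfig 4 G), MeasureTheory.IsProbabilityMeasure μ ∧
          μ ∈ ymGibbsMeasures (d := 4) r.ρ β ∧
          μ.map (configShift (Pi.single 0 1)) = μ ∧ μ.map (configShift (Pi.single 1 1)) = μ ∧
          ∀ (F₁ F₂ : LGConfig 4 G → ℝ) (S₁ S₂ : Finset (ZdEdge 4)), Measurable F₁ → Measurable F₂ →
            IsCylinder F₁ S₁ → IsCylinder F₂ S₂ → (∃ a : ℝ, ∀ U, |F₁ U| ≤ a) → (∃ b : ℝ, ∀ U, |F₂ U| ≤ b) →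
            ∃ C : ℝ, ∀ n : ℕ,
              |(∫ U, F₁ U * F₂ (configShift (-Pi.single 0 (n : ℤ)) U) ∂μ) -
                  (∫ U, F₁ U ∂μ) * (∫ U, F₂ (configShift (-Pi.single 0 (n : ℤ)) U) ∂μ)| ≤
                C * Real.exp (-(m * n)) := by
  intro G _ _ _ _ _ _ hG r
  dsimp only
  intro β m hm hfam
  classical
  -- `G` is Hausdorff and second countable through the faithful matrix representation `r`
  haveI : T2Space G := (r.continuous.isClosedEmbedding r.injective).isEmbedding.t2Space
  haveI : SecondCountableTopology G :=
    (r.continuous.isClosedEmbedding r.injective).isEmbedding.secondCountableTopology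
  have hρ : Continuous r.ρ := r.continuous
  -- the constants and floors of the tube family
  choose C hC using hfam
  choose Lmin hT using hC
  -- the diagonal tube sequence: width `k`, length `Lk k`
  let Lk : ℕ → ℕ := fun k => (k + 1) + ∑ w ∈ Finset.range (k + 1), Lmin w k
  have hLk_ge : ∀ k, k + 1 ≤ Lk k := fun k => Nat.le_add_right _ _
  have hLk_floor : ∀ w k, w ≤ k → Lmin w k ≤ Lk k := fun w k hwk =>
    le_add_left ((single_le_sum (f := fun w => Lmin w k) (fun _ _ => Nat.zero_le _)
      (mem_range.2 (Nat.lt_succ_of_le hwk))))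
  haveI hLk_pos : ∀ k, NeZero (Lk k) := fun k => ⟨by have := hLk_ge k; omega⟩
  -- tube vocabulary at level `k` (width `M = k`, length `L = Lk k`)
  let St : ℕ → Type := fun k => ZMod (Lk k) × ZMod (Lk k) × Fin (k + 1) × Fin (k + 1)
  let sh : (k : ℕ) → St k → Fin 4 → St k := fun k x μ =>
    ![(x.1 + 1, x.2.1, x.2.2.1, x.2.2.2), (x.1, x.2.1 + 1, x.2.2.1, x.2.2.2),
      (x.1, x.2.1, x.2.2.1 + 1, x.2.2.2), (x.1, x.2.1, x.2.2.1, x.2.2.2 + 1)] μ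
  let ins : (k : ℕ) → St k → Fin 4 → Fin 4 → ℝ := fun k x μ κ =>
    if ((μ = 2 ∨ κ = 2) → (x.2.2.1 : ℕ) < k) ∧ ((μ = 3 ∨ κ = 3) → (x.2.2.2 : ℕ) < k) then 1 else 0
  let act : (k : ℕ) → (St k × Fin 4 → G) → ℝ := fun k U =>
    β * ∑ x : St k, ∑ q : {q : Fin 4 × Fin 4 // q.1 < q.2}, ins k x q.1.1 q.1.2 *
      (r.ρ (U (x, q.1.1) * U (sh k x q.1.1, q.1.2) * (U (sh k x q.1.2, q.1.1))⁻¹ *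
        (U (x, q.1.2))⁻¹)).trace.re
  let fM : (k : ℕ) → ℤ → Fin (k + 1) := fun k z =>
    ⟨min (z + ((k / 2 : ℕ) : ℤ)).toNat k, Nat.lt_succ_of_le (min_le_right _ _)⟩
  let ψ : (k : ℕ) → Site 4 → St k := fun k x =>
    (((x 0 : ℤ) : ZMod (Lk k)), ((x 1 : ℤ) : ZMod (Lk k)), fM k (x 2), fM k (x 3))
  let π : (k : ℕ) → ZdEdge 4 → St k × Fin 4 := fun k e => (ψ k e.1, e.2)
  let ν : (k : ℕ) → Measure (St k × Fin 4 → G) := fun k =>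
    Measure.pi fun _ => haarProbability G
  let τ : (k : ℕ) → Measure (St k × Fin 4 → G) := fun k => (ν k).tilted (act k)
  let P : ℕ → Measure (LGConfig 4 G) := fun k => (τ k).map fun V => V ∘ π k
  let σ : (k : ℕ) → ℕ → (St k × Fin 4 → G) → (St k × Fin 4 → G) := fun k n U p =>
    U ((p.1.1 + n, p.1.2), p.2)
  -- the tube weights are bounded continuous, the tube states are probability measures
  have hact_cont : ∀ k, Continuous (act k) := fun k => by
    refine continuous_const.mul (continuous_finsetSum _ fun x _ =>
      continuous_finsetSum _ fun q _ => continuous_const.mul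
        (Complex.continuous_re.comp (Continuous.matrix_trace (hρ.comp ?_))))
    fun_prop
  have hν_prob : ∀ k, IsProbabilityMeasure (ν k) := fun k => by
    simp only [ν]; infer_instance
  have hτ_prob : ∀ k, IsProbabilityMeasure (τ k) := fun k => by
    obtain ⟨Bd, hBd⟩ := exists_bound_of_continuous (Real.continuous_exp.comp (hact_cont k))
    exact isProbabilityMeasure_tilted (integrable_of_bound
      (Real.continuous_exp.comp (hact_cont k)).aestronglyMeasurable hBd)
  have hπ_meas : ∀ k, Measurable fun V : St k × Fin 4 → G => (V ∘ π k : LGConfig 4 G) :=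
    fun k => measurable_comp_chart (π k)
  haveI hP_prob : ∀ k, IsProbabilityMeasure (P k) := fun k =>
    Measure.isProbabilityMeasure_map (hπ_meas k).aemeasurable
  -- integrals against the tube states
  have hP_int : ∀ k (F : LGConfig 4 G → ℝ), Measurable F →
      ∫ U, F U ∂(P k) = (∫ V, F (V ∘ π k) * Real.exp (act k V) ∂(ν k)) /
        ∫ V, Real.exp (act k V) ∂(ν k) := by
    intro k F hF
    simp only [P, τ]
    rw [integral_map (hπ_meas k).aemeasurable hF.aestronglyMeasurable, integral_tilted_eq_div]
  -- Euclidean time shifts on the tube are charted time translations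
  have hshift : ∀ k (n : ℕ) (V : St k × Fin 4 → G),
      (σ k n V ∘ π k : LGConfig 4 G) = configShift (-Pi.single 0 (n : ℤ)) (V ∘ π k) := by
    intro k n V
    funext e
    simp [σ, π, ψ, configShift_apply, sub_neg_eq_add, Pi.add_apply, Int.cast_add, Int.cast_natCast]
  -- the local DLR identities hold on the tubes for all large `k`
  have hlocal : ∀ (Λ S₀ : Finset (ZdEdge 4)) (F : LGConfig 4 G → ℝ), Measurable F →
      IsCylinder F S₀ → ∀ Cb : ℝ, (∀ U, |F U| ≤ Cb) → ∀ᶠ k in atTop,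
        ∫ U, F U ∂(P k) = ∫ η, (∫ U, F U ∂(ymSpecification r.ρ β Λ η)) ∂(P k) := by
    intro Λ S₀ F hFm hFS Cb hCb
    set Bs : Finset (Site 4) :=
      (Λ ∪ S₀ ∪ (plaquettesTouching Λ).biUnion plaquetteEdges).image Prod.fst with hBs
    set R : ℕ := Bs.sup fun x => Finset.univ.sup fun i => (x i).natAbs with hR
    have hRB : ∀ x ∈ Bs, ∀ i, (x i).natAbs ≤ R := fun x hx i =>
      (Finset.le_sup (f := fun i => (x i).natAbs) (Finset.mem_univ i)).trans
        (Finset.le_sup (f := fun x => Finset.univ.sup fun i => (x i).natAbs) hx)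
    filter_upwards [eventually_ge_atTop (2 * R + 4)] with k hk
    have hkL : 2 * R + 1 ≤ Lk k := by have := hLk_ge k; omega
    obtain ⟨hinjψ, hstep, hpred, hins⟩ := tubeChart_good k (Lk k) R Bs hRB hk hkL
    obtain ⟨hinjπ, a, b, c, hac, hbc, ha, hb, hsplit⟩ :=
      chart_action_split (sh k) (ψ k) Bs (ins k) r.ρ hρ β hinjψ hstep hpred hins Λ S₀
        Finset.Subset.rfl
    have hsplit' : ∀ V, act k V = a V + b V := hsplit
    have hγm : Measurable fun η : LGConfig 4 G => ∫ U, F U ∂(ymSpecification r.ρ β Λ η) :=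
      measurable_integral_ymSpecification r.ρ hρ β Λ hFm
    rw [hP_int k F hFm, hP_int k _ hγm]
    have e1 : (fun V : St k × Fin 4 → G => F (V ∘ π k) * Real.exp (act k V)) =
        fun V => Real.exp (a V + b V) * F (V ∘ π k) := by
      funext V; rw [hsplit' V]; ring
    have e2 : (fun V : St k × Fin 4 → G =>
        (∫ U, F U ∂(ymSpecification r.ρ β Λ (V ∘ π k))) * Real.exp (act k V)) =
        fun V => Real.exp (a V + b V) * ∫ U, F U ∂(ymSpecification r.ρ β Λ (V ∘ π k)) := by
      funext V; rw [hsplit' V]; ring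
    rw [e1, e2, integral_weight_comp_chart_eq_condAvg r.ρ (π k) hρ β Λ S₀ hinjπ hac hbc ha hb
      hFm hCb hFS]
  -- a weak limit point of the tube states (Prokhorov on the compact metrisable configuration space)
  let Pm : ℕ → ProbabilityMeasure (LGConfig 4 G) := fun k => ⟨P k, hP_prob k⟩
  obtain ⟨μp, -, φ, hφ, hlimφ⟩ :=
    (isCompact_univ (X := ProbabilityMeasure (LGConfig 4 G))).tendsto_subseq
      fun k => Set.mem_univ (Pm k)
  have hlimF : ∀ F : LGConfig 4 G → ℝ, Continuous F → (∃ Cb, ∀ U, |F U| ≤ Cb) →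
      Tendsto (fun k => ∫ U, F U ∂(P (φ k))) atTop (𝓝 (∫ U, F U ∂(μp : Measure (LGConfig 4 G)))) := by
    intro F hFc hFb
    obtain ⟨Cb, hCb⟩ := hFb
    let Fb : BoundedContinuousFunction (LGConfig 4 G) ℝ :=
      BoundedContinuousFunction.ofNormedAddCommGroup F hFc Cb
        (fun U => by simpa [Real.norm_eq_abs] using hCb U)
    exact (ProbabilityMeasure.tendsto_iff_forall_integral_tendsto.1 hlimφ) Fb
  obtain ⟨hGibbs, hconv⟩ := mem_ymGibbsMeasures_of_tendsto_of_localDLR (d := 4) r.ρ hρ β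
    (fun k => P (φ k)) (μp : Measure (LGConfig 4 G)) hlimF
    (fun Λ S₀ F hFm hFS Cb hCb => hφ.tendsto_atTop.eventually (hlocal Λ S₀ F hFm hFS Cb hCb))
  -- invariance under the two long translations: exact on every tube, preserved in the limit
  have hinvP : ∀ (k : ℕ) (v : Site 4) (t : St k ≃ St k), (∀ x μ, t (sh k x μ) = sh k (t x) μ) →
      (∀ x, (t x).2.2 = x.2.2) → (∀ x : Site 4, ψ k (x - v) = t (ψ k x)) →
      (P k).map (configShift v) = P k := by
    intro k v t htsh ht2 htψ
    have hins : ∀ x μ κ, ins k (t x) μ κ = ins k x μ κ := fun x μ κ => by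
      simp only [ins, ht2 x]
    set θ : St k × Fin 4 → St k × Fin 4 := fun p => (t p.1, p.2) with hθ
    have hθinj : Injective θ := fun p q h => by
      simp only [hθ, Prod.mk.injEq, EmbeddingLike.apply_eq_iff_eq] at h
      exact Prod.ext h.1 h.2
    refine map_configShift_chartState_eq (π k) (hact_cont k) hθinj (fun V => ?_) v (fun V => ?_)
    · simp only [act]
      congr 1
      refine Fintype.sum_equiv t _ _ fun x => Finset.sum_congr rfl fun q _ => ?_
      simp only [hθ, Function.comp_apply, htsh x, hins x]
    · funext e
      simp only [configShift_apply, π, hθ, Function.comp_apply, htψ]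
  have ht0 : ∀ k, ∃ t : St k ≃ St k, (∀ x μ, t (sh k x μ) = sh k (t x) μ) ∧ (∀ x, (t x).2.2 = x.2.2) ∧
      ∀ x : Site 4, ψ k (x - Pi.single 0 1) = t (ψ k x) := by
    intro k
    refine ⟨⟨fun x => (x.1 - 1, x.2), fun x => (x.1 + 1, x.2), fun x => by simp, fun x => by simp⟩,
      ?_, fun x => rfl, ?_⟩
    · intro x μ
      fin_cases μ <;> simp [sh]
    · intro x
      simp [ψ, Pi.sub_apply, Int.cast_sub, Int.cast_one]
  have ht1 : ∀ k, ∃ t : St k ≃ St k, (∀ x μ, t (sh k x μ) = sh k (t x) μ) ∧ (∀ x, (t x).2.2 = x.2.2) ∧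
      ∀ x : Site 4, ψ k (x - Pi.single 1 1) = t (ψ k x) := by
    intro k
    refine ⟨⟨fun x => (x.1, x.2.1 - 1, x.2.2), fun x => (x.1, x.2.1 + 1, x.2.2), fun x => by simp,
      fun x => by simp⟩, ?_, fun x => rfl, ?_⟩
    · intro x μ
      fin_cases μ <;> simp [sh]
    · intro x
      simp [ψ, Pi.sub_apply, Int.cast_sub, Int.cast_one]
  have hinv : ∀ v : Site 4, (∀ k, ∃ t : St k ≃ St k, (∀ x μ, t (sh k x μ) = sh k (t x) μ) ∧
      (∀ x, (t x).2.2 = x.2.2) ∧ ∀ x : Site 4, ψ k (x - v) = t (ψ k x)) →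
      (μp : Measure (LGConfig 4 G)).map (configShift v) = μp := by
    intro v hv
    refine map_eq_of_tendsto_of_map_eq (fun k => P (φ k)) (μp : Measure (LGConfig 4 G))
      (continuous_configShift v) (configShift v).measurable (fun k => ?_) hlimF
    obtain ⟨t, h1, h2, h3⟩ := hv (φ k)
    exact hinvP (φ k) v t h1 h2 h3
  refine ⟨(μp : Measure (LGConfig 4 G)), inferInstance, hGibbs, hinv _ ht0, hinv _ ht1,
    fun F₁ F₂ S₁ S₂ hF₁m hF₂m hF₁S hF₂S haF hbF => ?_⟩
  -- clustering: the `M`-uniform tube bound passes to the limit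
  obtain ⟨a₀, ha₀⟩ := haF
  obtain ⟨b₀, hb₀⟩ := hbF
  set a : ℝ := max a₀ 1 with ha_def
  set b : ℝ := max b₀ 1 with hb_def
  have ha_pos : 0 < a := lt_of_lt_of_le one_pos (le_max_right _ _)
  have hb_pos : 0 < b := lt_of_lt_of_le one_pos (le_max_right _ _)
  have haA : ∀ U, |F₁ U| ≤ a := fun U => (ha₀ U).trans (le_max_left _ _)
  have hbB : ∀ U, |F₂ U| ≤ b := fun U => (hb₀ U).trans (le_max_left _ _)
  -- time radius of the supports and the slab width
  set R₀ : ℕ := (S₁ ∪ S₂).sup fun e => (e.1 0).natAbs with hR₀_def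
  have hR₀ : ∀ e ∈ S₁ ∪ S₂, (e.1 0).natAbs ≤ R₀ := fun e he =>
    Finset.le_sup (f := fun e : ZdEdge 4 => (e.1 0).natAbs) he
  set w : ℕ := 2 * R₀ with hw_def
  refine ⟨a * b * C w, fun n => ?_⟩
  obtain ⟨hABm, hABcyl, hBnm, hBncyl⟩ := prodShift_cylinder' hF₁m hF₂m hF₁S hF₂S (-Pi.single 0 (n : ℤ))
  have hX := hconv _ _ hABm hABcyl (a * b) (fun U => by
    rw [abs_mul]; exact mul_le_mul (haA _) (hbB _) (abs_nonneg _) ((abs_nonneg _).trans (haA U)))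
  have hY := hconv _ _ hF₁m hF₁S a haA
  have hZ := hconv _ _ hBnm hBncyl b (fun U => hbB _)
  -- the tube bound along the subsequence, for all large `k`
  have hbound : ∀ᶠ k in atTop,
      |(∫ U, F₁ U * F₂ (configShift (-Pi.single 0 (n : ℤ)) U) ∂(P (φ k))) -
          (∫ U, F₁ U ∂(P (φ k))) *
            (∫ U, F₂ (configShift (-Pi.single 0 (n : ℤ)) U) ∂(P (φ k)))| ≤
        a * b * C w * Real.exp (-(m * n)) := by
    filter_upwards [hφ.tendsto_atTop.eventually (eventually_ge_atTop (max w (2 * n)))] with k hk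
    set k' := φ k with hk'
    have hwk : w ≤ k' := (le_max_left _ _).trans hk
    have hnk : 2 * n < Lk k' := by
      have h1 := hLk_ge k'; have h2 := (le_max_right _ _).trans hk; omega
    have hLw : 2 * R₀ + 1 ≤ Lk k' := by have h1 := hLk_ge k'; omega
    -- the normalised charted observables are slab-local of width `w` at time `-R₀`
    set cc : ZMod (Lk k') := (((-(R₀ : ℤ)) : ℤ) : ZMod (Lk k')) with hcc
    set Φ₁ : (St k' × Fin 4 → G) → ℝ := fun V => F₁ (V ∘ π k') / a with hΦ₁
    set Φ₂ : (St k' × Fin 4 → G) → ℝ := fun V => F₂ (V ∘ π k') / b with hΦ₂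
    have hloc : ∀ (X : LGConfig 4 G → ℝ) (SX : Finset (ZdEdge 4)) (x : ℝ), Measurable X →
        IsCylinder X SX → 0 < x → (∀ U, |X U| ≤ x) → SX ⊆ S₁ ∪ S₂ →
        Measurable (fun V : St k' × Fin 4 → G => X (V ∘ π k') / x) ∧
          (∀ V, |X (V ∘ π k') / x| ≤ 1) ∧
          ∀ V V' : St k' × Fin 4 → G, (∀ p : St k' × Fin 4, (p.1.1 - cc).val ≤ w → V p = V' p) →
            X (V ∘ π k') / x = X (V' ∘ π k') / x := by
      intro X SX x hXm hXS hx hXx hsupp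
      refine ⟨(hXm.comp (hπ_meas k')).div_const x, fun V => ?_, fun V V' hVV' => ?_⟩
      · rw [abs_div, abs_of_pos hx, div_le_one hx]; exact hXx _
      · congr 1
        refine hXS fun e he => ?_
        simp only [Function.comp_apply]
        refine hVV' (π k' e) ?_
        have heR : (e.1 0).natAbs ≤ R₀ := hR₀ e (hsupp (mem_coe.1 he))
        exact zmod_val_sub_neg_le heR hLw
    have hL1 := hloc F₁ S₁ a hF₁m hF₁S ha_pos haA subset_union_left
    have hL2 := hloc F₂ S₂ b hF₂m hF₂S hb_pos hbB subset_union_right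
    -- the tube clustering bound at level `k'`
    have key : |(∫ V, Φ₁ V * Φ₂ (σ k' n V) * Real.exp (act k' V) ∂(ν k')) /
          (∫ V, Real.exp (act k' V) ∂(ν k')) -
        (∫ V, Φ₁ V * Real.exp (act k' V) ∂(ν k')) / (∫ V, Real.exp (act k' V) ∂(ν k')) *
          ((∫ V, Φ₂ (σ k' n V) * Real.exp (act k' V) ∂(ν k')) /
            (∫ V, Real.exp (act k' V) ∂(ν k')))| ≤ C w * Real.exp (-(m * n)) :=
      hT w k' (Lk k') (hLk_floor w k' hwk) cc Φ₁ Φ₂ hL1 hL2 n hnk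
    -- identification of the three tube expectations with integrals against `P k'`
    have i1 : (∫ V, Φ₁ V * Φ₂ (σ k' n V) * Real.exp (act k' V) ∂(ν k')) /
        (∫ V, Real.exp (act k' V) ∂(ν k')) =
        (∫ U, F₁ U * F₂ (configShift (-Pi.single 0 (n : ℤ)) U) ∂(P k')) / (a * b) := by
      rw [hP_int k' _ hABm, div_right_comm, ← integral_div (a * b)]
      congr 1
      refine integral_congr_ae (ae_of_all _ fun V => ?_)
      simp only [hΦ₁, hΦ₂]
      rw [hshift k' n V]
      ring
    have i2 : (∫ V, Φ₁ V * Real.exp (act k' V) ∂(ν k')) / (∫ V, Real.exp (act k' V) ∂(ν k')) =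
        (∫ U, F₁ U ∂(P k')) / a := by
      rw [hP_int k' _ hF₁m, div_right_comm, ← integral_div a]
      congr 1
      refine integral_congr_ae (ae_of_all _ fun V => ?_)
      simp only [hΦ₁]
      ring
    have i3 : (∫ V, Φ₂ (σ k' n V) * Real.exp (act k' V) ∂(ν k')) /
        (∫ V, Real.exp (act k' V) ∂(ν k')) =
        (∫ U, F₂ (configShift (-Pi.single 0 (n : ℤ)) U) ∂(P k')) / b := by
      rw [hP_int k' _ hBnm, div_right_comm, ← integral_div b]
      congr 1
      refine integral_congr_ae (ae_of_all _ fun V => ?_)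
      simp only [hΦ₂]
      rw [hshift k' n V]
      ring
    rw [i1, i2, i3] at key
    have hab : 0 < a * b := mul_pos ha_pos hb_pos
    have ha0 : a ≠ 0 := ha_pos.ne'
    have hb0 : b ≠ 0 := hb_pos.ne'
    have key' := mul_le_mul_of_nonneg_left key (abs_nonneg (a * b))
    rw [← abs_mul, abs_of_pos hab] at key'
    have halg : a * b * ((∫ U, F₁ U * F₂ (configShift (-Pi.single 0 (n : ℤ)) U) ∂(P k')) / (a * b) -
        (∫ U, F₁ U ∂(P k')) / a * ((∫ U, F₂ (configShift (-Pi.single 0 (n : ℤ)) U) ∂(P k')) / b)) =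
        (∫ U, F₁ U * F₂ (configShift (-Pi.single 0 (n : ℤ)) U) ∂(P k')) -
          (∫ U, F₁ U ∂(P k')) * (∫ U, F₂ (configShift (-Pi.single 0 (n : ℤ)) U) ∂(P k')) := by
      field_simp
    rw [halg] at key'
    calc _ ≤ a * b * (C w * Real.exp (-(m * n))) := key'
      _ = a * b * C w * Real.exp (-(m * n)) := by ring
  -- pass to the limit along the subsequence
  have hlim : Tendsto (fun k => |(∫ U, F₁ U * F₂ (configShift (-Pi.single 0 (n : ℤ)) U) ∂(P (φ k))) -
      (∫ U, F₁ U ∂(P (φ k))) * (∫ U, F₂ (configShift (-Pi.single 0 (n : ℤ)) U) ∂(P (φ k)))|)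
      atTop (𝓝 |(∫ U, F₁ U * F₂ (configShift (-Pi.single 0 (n : ℤ)) U) ∂(μp : Measure (LGConfig 4 G))) -
        (∫ U, F₁ U ∂(μp : Measure (LGConfig 4 G))) *
          (∫ U, F₂ (configShift (-Pi.single 0 (n : ℤ)) U) ∂(μp : Measure (LGConfig 4 G)))|) :=
    (hX.sub (hY.mul hZ)).abs
  exact le_of_tendsto hlim hbound

end Summit.QuantumFields.YangMills.Theorems.FibreToTorus

end
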